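import Summits.QuantumFields.GaugeBoot.TiltedBoxTwoDimEvenSiteAnnulus
import HarnessLib

/-!
# Reduced-half site RP on the even square tilted box in two dimensions: the split of the Boltzmann weight (gauge-boot, L3 supplement: 2D slab gluing, reduced-half site mirror 3/4)

HONEST FRAMING (cell `pub-gaugeboot`, page 1 of every file): the venture produces certified bounds
on lattice expectations at stated coupling, gauge group, dimension and torus size; NOT a mass gap,
NOT a continuum limit, NOT a string tension; NOT Yang–Mills-summit-bearing (barriers
`FixedCouplingUltralocality`, `PerturbativeInvisibility`). Bookkeeping for the POSITIVE two-dimensional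
result `TiltedBoxEvenAxisRPTwoDim.lean`; it discharges nothing else.

Even square box `ℤ^d/Γ(2P, 2P, L)`, `P ≥ 2`, two dimensions, site mirror `Θ_i : x_i ↦ -x_i`, REDUCED half
`{0 ≤ x_i ≤ P - 1}` (observables `F` with `F U = F V` whenever `U`, `V` agree on the links `IsRedSiteLink`):

* `gEv = F · e^{-βE}` (`E = redSiteExpo`) and the integrand `hEv = g · conj(g ∘ Θ_i)`; both are read off
  the shared and positive links and their mirror images, so `hEv` does not see the rungs of the two
  annuli (`hEv_update_rung`, base layers `P - 1`, `P`) nor the letters of the free layer `x_i ≡ P`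
  (`hEv_update_freeLetter`); measurability and bounds;
* **`boltzmann_split_even`** — `e^{-βS} conj F(Θ_i U) F(U) = (e^{-βN·2M})² · hEv · ∏_{P-1|P} · ∏_{P|P+1}`
  with the two annulus products of one-plaquette weights `SlabKernel.plaqWt` (`M = 2P`;
  `redSiteExpo_configReflect_add` and `exp_slabSq_eq`).

References: K. Osterwalder, E. Seiler, Ann. Phys. 110 (1978) 440, §2; A. A. Migdal, Sov. Phys. JETP 42
(1975) 413.
-/

noncomputable section

open MeasureTheory Complex Function
open scoped ComplexOrder ComplexConjugate
open Literature.MathematicalPhysics.QuantumFieldTheory (haarProbability)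
open Literature.RepresentationTheory.CompactGroups

namespace Summit.QuantumFields.GaugeBoot

namespace TiltedRP

namespace TwoDim

variable {d : ℕ} {i j : Fin d} {L P N : ℕ} [NeZero L] [NeZero P]
variable {G : Type*} [Group G] [TopologicalSpace G] [IsTopologicalGroup G] [CompactSpace G]
  [MeasurableSpace G] [BorelSpace G] [SecondCountableTopology G]
variable (ρ : G →* Matrix (Fin N) (Fin N) ℂ)

/-! ## The half observable and the integrand -/

/-- The half-weighted observable `g = F · e^{-β E}` (`E = redSiteExpo`). -/
def gEv (β : ℝ) (F : Config (TiltedSite d i j (2 * P) (2 * P) L) d G → ℂ)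
    (U : Config (TiltedSite d i j (2 * P) (2 * P) L) d G) : ℂ :=
  F U * (Real.exp (-β * redSiteExpo ρ U) : ℂ)

/-- The integrand after the split: `h = g · conj(g ∘ Θ_i)`. -/
def hEv (β : ℝ) (F : Config (TiltedSite d i j (2 * P) (2 * P) L) d G → ℂ) (hij : i ≠ j)
    (U : Config (TiltedSite d i j (2 * P) (2 * P) L) d G) : ℂ :=
  gEv ρ β F U * conj (gEv ρ β F (configReflect (tiltedUnit d i j (2 * P) (2 * P) L) i
    (tiltedAxisFlip d L (2 * P) hij) U))

omit [TopologicalSpace G] [IsTopologicalGroup G] [CompactSpace G] [MeasurableSpace G] [BorelSpace G]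
  [SecondCountableTopology G] in
/-- `g` is read off the shared and positive links (two dimensions). [folklore] -/
theorem gEv_eq_of_blocks (hP : 2 ≤ P) (hij : i ≠ j) (hd : ∀ k : Fin d, k = i ∨ k = j) (β : ℝ)
    {F : Config (TiltedSite d i j (2 * P) (2 * P) L) d G → ℂ}
    (hFo : ∀ U V : Config (TiltedSite d i j (2 * P) (2 * P) L) d G, (∀ l, IsRedSiteLink l → U l = V l) → F U = F V)
    {U V : Config (TiltedSite d i j (2 * P) (2 * P) L) d G}
    (hUV : ∀ l, (l ∈ posBlockE d i j L P ∨ l ∈ shBlockE d i j L P) → U l = V l) :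
    gEv ρ β F U = gEv ρ β F V := by
  unfold gEv
  rw [hFo U V (fun l hl => hUV l ((isRedSiteLink_iff_mem_blocksE hP hij hd l).1 hl)), redSiteExpo_eq_of_blocks ρ hP hij hd hUV]

/-- `g` is measurable and bounded. [folklore] -/
theorem measurable_gEv_and_bound (hρ : Continuous ρ) (β : ℝ)
    {F : Config (TiltedSite d i j (2 * P) (2 * P) L) d G → ℂ} (hFm : Measurable F) {CF : ℝ}
    (hFb : ∀ U, ‖F U‖ ≤ CF) :
    Measurable (gEv ρ β F) ∧ ∃ Cg : ℝ, ∀ U, ‖gEv ρ β F U‖ ≤ Cg := by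
  obtain ⟨CE, hCE⟩ := (isCompact_univ (X := Config (TiltedSite d i j (2 * P) (2 * P) L) d G)).exists_bound_of_continuousOn
    (continuous_redSiteExpo (L := L) (P := P) ρ hρ).continuousOn
  refine ⟨hFm.mul (Complex.measurable_ofReal.comp
    ((Real.continuous_exp.comp (continuous_const.mul (continuous_redSiteExpo ρ hρ))).measurable)),
    CF * Real.exp (|β| * CE), fun U => ?_⟩
  rw [gEv, norm_mul, Complex.norm_real, Real.norm_eq_abs, abs_of_pos (Real.exp_pos _)]
  refine mul_le_mul (hFb U) (Real.exp_le_exp.2 ?_) (Real.exp_pos _).le ((norm_nonneg _).trans (hFb U))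
  calc -β * redSiteExpo ρ U ≤ |-β * redSiteExpo ρ U| := le_abs_self _
    _ = |β| * |redSiteExpo ρ U| := by rw [abs_mul, abs_neg]
    _ ≤ |β| * CE := mul_le_mul_of_nonneg_left (by simpa using hCE U (Set.mem_univ _)) (abs_nonneg _)

/-- `h` is measurable and bounded. [folklore] -/
theorem measurable_hEv_and_bound (hij : i ≠ j) (hρ : Continuous ρ) (β : ℝ)
    {F : Config (TiltedSite d i j (2 * P) (2 * P) L) d G → ℂ} (hFm : Measurable F) {CF : ℝ}
    (hFb : ∀ U, ‖F U‖ ≤ CF) :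
    Measurable (hEv ρ β F hij) ∧ ∃ Ch : ℝ, ∀ U, ‖hEv ρ β F hij U‖ ≤ Ch := by
  obtain ⟨hgm, Cg, hgb⟩ := measurable_gEv_and_bound ρ hρ β hFm hFb
  have hΘm := ((isAxisFlip_tiltedAxisFlip d L (2 * P) hij).measurePreserving_configReflect (G := G)).measurable
  refine ⟨hgm.mul (Complex.continuous_conj.measurable.comp (hgm.comp hΘm)), Cg * Cg, fun U => ?_⟩
  rw [hEv, norm_mul, Complex.norm_conj]
  exact mul_le_mul (hgb U) (hgb _) (norm_nonneg _) ((norm_nonneg _).trans (hgb U))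

omit [TopologicalSpace G] [IsTopologicalGroup G] [CompactSpace G] [MeasurableSpace G] [BorelSpace G]
  [SecondCountableTopology G] in
/-- `h` does not see the rungs of the two annuli (base layers `x_i ∈ {P - 1, P}`). [folklore] -/
theorem hEv_update_rung [DecidableEq (TiltedSite d i j (2 * P) (2 * P) L)] (hP : 2 ≤ P) (hij : i ≠ j)
    (hd : ∀ k : Fin d, k = i ∨ k = j) (β : ℝ) {F : Config (TiltedSite d i j (2 * P) (2 * P) L) d G → ℂ}
    (hFo : ∀ U V : Config (TiltedSite d i j (2 * P) (2 * P) L) d G, (∀ l, IsRedSiteLink l → U l = V l) → F U = F V)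
    {y : TiltedSite d i j (2 * P) (2 * P) L}
    (hy : (axisCoord d L (2 * P) y).val = P - 1 ∨ (axisCoord d L (2 * P) y).val = P) (s : ℕ)
    (U : Config (TiltedSite d i j (2 * P) (2 * P) L) d G) (z : G) :
    hEv ρ β F hij (update U (rungAt y s) z) = hEv ρ β F hij U := by
  unfold hEv rungAt
  congr 1
  · exact gEv_eq_of_blocks ρ hP hij hd β hFo fun l hl => update_rung_apply_of_mem_blocksE hij U hy s z l hl
  · congr 1
    exact gEv_eq_of_blocks ρ hP hij hd β hFo fun l hl => configReflect_update_rung_even hP hij hd U hy s z l hl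

omit [TopologicalSpace G] [IsTopologicalGroup G] [CompactSpace G] [MeasurableSpace G] [BorelSpace G]
  [SecondCountableTopology G] in
/-- `h` does not see the letters of the free layer `x_i ≡ P`. [folklore] -/
theorem hEv_update_freeLetter [DecidableEq (TiltedSite d i j (2 * P) (2 * P) L)] (hP : 2 ≤ P) (hij : i ≠ j)
    (hd : ∀ k : Fin d, k = i ∨ k = j) (β : ℝ) {F : Config (TiltedSite d i j (2 * P) (2 * P) L) d G → ℂ}
    (hFo : ∀ U V : Config (TiltedSite d i j (2 * P) (2 * P) L) d G, (∀ l, IsRedSiteLink l → U l = V l) → F U = F V)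
    {x : TiltedSite d i j (2 * P) (2 * P) L} (hx : (axisCoord d L (2 * P) x).val = P)
    (U : Config (TiltedSite d i j (2 * P) (2 * P) L) d G) (z : G) :
    hEv ρ β F hij (update U (x, j) z) = hEv ρ β F hij U := by
  unfold hEv
  congr 1
  · exact gEv_eq_of_blocks ρ hP hij hd β hFo fun l hl => update_freeLetter_apply_of_mem_blocksE hij U hx z l hl
  · congr 1
    exact gEv_eq_of_blocks ρ hP hij hd β hFo fun l hl => configReflect_update_freeLetter_even hP hij hd U hx z l hl

/-! ## The split of the Boltzmann weight -/

omit [NeZero L] [NeZero P] in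
/-- The two rung layers are distinct classes. [folklore] -/
theorem rungLayersE_ne (hP : 2 ≤ P) : ((P : ℕ) : ZMod (2 * P)) - 1 ≠ ((P : ℕ) : ZMod (2 * P)) := by
  intro h
  have h1 := congrArg ZMod.val h
  rw [val_natCast_sub_one hP, val_natCast_self hP] at h1
  omega

omit [MeasurableSpace G] [BorelSpace G] [SecondCountableTopology G] in
open scoped Classical in
/-- **The split of the Boltzmann weight of the reduced-half site mirror**:
`e^{-βS(U)} conj F(Θ_i U) F(U) = (e^{-βN·2M})² · h(U) · ∏_{P-1|P} plaqWt · ∏_{P|P+1} plaqWt`,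
`M = 2P`, the annuli through `y₋ = [(P-1) e_i]` and `y₀ = [P e_i]`. [folklore] -/
theorem boltzmann_split_even (hP : 2 ≤ P) (hij : i ≠ j) (hd : ∀ k : Fin d, k = i ∨ k = j) (hρ : Continuous ρ)
    (β : ℝ) (F : Config (TiltedSite d i j (2 * P) (2 * P) L) d G → ℂ)
    (U : Config (TiltedSite d i j (2 * P) (2 * P) L) d G) :
    (Real.exp (-β * wilsonAction ρ (tiltedUnit d i j (2 * P) (2 * P) L) U) : ℂ) *
      (conj (F (configReflect (tiltedUnit d i j (2 * P) (2 * P) L) i (tiltedAxisFlip d L (2 * P) hij) U)) * F U) =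
      ((Real.exp (-β * N * (2 * (2 * P))) : ℂ) * (Real.exp (-β * N * (2 * (2 * P))) : ℂ)) *
        (hEv ρ β F hij U *
          (∏ t ∈ Finset.range (2 * (2 * P)), SlabKernel.plaqWt (SlabKernel.wilsonWt ρ β)
              (rungAt (predLayerSite d L P : TiltedSite d i j (2 * P) (2 * P) L)) (loAt (predLayerSite d L P))
              (upAt (predLayerSite d L P)) t U) *
          ∏ t ∈ Finset.range (2 * (2 * P)), SlabKernel.plaqWt (SlabKernel.wilsonWt ρ β)
              (rungAt (layerSite d L P : TiltedSite d i j (2 * P) (2 * P) L)) (loAt (layerSite d L P))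
              (upAt (layerSite d L P)) t U) := by
  have hE := redSiteExpo_configReflect_add (L := L) ρ hP hij hd hρ U
  set f : Plaq (TiltedSite d i j (2 * P) (2 * P) L) d → ℝ := fun p =>
    (N : ℝ) - plaqObs ρ (tiltedUnit d i j (2 * P) (2 * P) L) p U with hf
  have hdisj : Disjoint (Finset.univ.filter (SquareSlab.IsSlabPlaq (L := L) (i := i) (j := j) (((P : ℕ) : ZMod (2 * P)) - 1)))
      (Finset.univ.filter (SquareSlab.IsSlabPlaq ((P : ℕ) : ZMod (2 * P)))) := by
    rw [Finset.disjoint_filter]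
    intro p _ ha hb
    exact rungLayersE_ne hP (ha.2.symm.trans hb.2)
  have hsum : ∑ p ∈ Finset.univ.filter (fun p => SquareSlab.IsSlabPlaq (((P : ℕ) : ZMod (2 * P)) - 1) p ∨
        SquareSlab.IsSlabPlaq ((P : ℕ) : ZMod (2 * P)) p), f p =
      (∑ p ∈ Finset.univ.filter (SquareSlab.IsSlabPlaq (axisCoord d L (2 * P)
          (predLayerSite d L P : TiltedSite d i j (2 * P) (2 * P) L))), f p) +
      ∑ p ∈ Finset.univ.filter (SquareSlab.IsSlabPlaq (axisCoord d L (2 * P)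
          (layerSite d L P : TiltedSite d i j (2 * P) (2 * P) L))), f p := by
    rw [Finset.filter_or, Finset.sum_union hdisj, axisCoord_predLayerSite, axisCoord_layerSite]
  have hS : -β * wilsonAction ρ (tiltedUnit d i j (2 * P) (2 * P) L) U =
      -β * redSiteExpo ρ U + -β * redSiteExpo ρ (configReflect (tiltedUnit d i j (2 * P) (2 * P) L) i
        (tiltedAxisFlip d L (2 * P) hij) U) +
      (-β * ∑ p ∈ Finset.univ.filter (SquareSlab.IsSlabPlaq (axisCoord d L (2 * P)
          (predLayerSite d L P : TiltedSite d i j (2 * P) (2 * P) L))), f p +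
        -β * ∑ p ∈ Finset.univ.filter (SquareSlab.IsSlabPlaq (axisCoord d L (2 * P)
          (layerSite d L P : TiltedSite d i j (2 * P) (2 * P) L))), f p) := by
    rw [hsum] at hE
    linear_combination β * hE
  rw [hS, Real.exp_add, Real.exp_add, Real.exp_add, Complex.ofReal_mul, Complex.ofReal_mul, Complex.ofReal_mul]
  simp only [hf]
  rw [exp_slabSq_eq ρ hij hd hρ β _ U, exp_slabSq_eq ρ hij hd hρ β _ U, hEv, gEv, gEv, map_mul, Complex.conj_ofReal]
  push_cast
  ring

end TwoDim

end TiltedRP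

end Summit.QuantumFields.GaugeBoot

end
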